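import Summits.ABC.IUTFork.Repair.RHReqsideWeightLawsSignTierL1
import HarnessLib

/-!
# D-0122 AXIS B, knob k1 — THE TYPED FORM, part 3g: the DATUM at tier L1 — `DD(datum) = Σ_w DD_w·u_w`, the kept mass of record `K_L1 = M − DD(datum)`,
# `K_L1 ≥ K_L0`, and THE MEETS CELL OF RECORD `ρ = K_L1/(μ₀·M) ≥ 1 ⟺ DD(datum) ≤ (1 − μ₀)·M` in typed form, for every pilot law

abc-iut cell, rung LADDER-ABC:A2.RESCUE.H; seat abc-iut-reqb-typ-1 (GEN 3; D-0122 axis B typer k1/k4; R69 (A1) hardening queue); owner abc-iut-rh-lead g4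
(`plan/rescue/R-H/ROUND3/REQB-SPEC.md` v0.2 §6(a)(P2)/(P3): «ρ_mod := K_L1,mod/Req_mod`, `Req_mod := μ_tgt·M_mod` … DECIDING STATISTIC = THE COUNT: MEETS iff
`n_{≥1} = 133/133 AND 79/79`»; TOPT-LP-SPEC v1.2 §S3 tier L1 = (EX, none): `K_L1 = Σ_w (MM_w − DD_w)·u_w`, `u_w = ln p/(e_w·l⋆)`). Parts 3a–3f = p516945 /
p517864 / p519304 / p520175 / p520993 / p521933 (this seat: `offDemand` = T, `keptDemand` = K_L0, `datumOff`, `datumKept`, `margin`, `exactDeficit` = DD);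
part 2 = p508156 (`reqMass` = M, `reqThreshold`). Nothing re-typed; everything BY NAME.
* §1 `datumDeficit f den s e m δ r_in r_out u L := Σ_{w∈s} DD_w·u_w` (nats; place weights `u_w ≥ 0`; the kit's datum ↔ places map is the index set `s`):
  `datumDeficit_nonneg`; **`datumDeficit_mono_law`** (cross-denominator: a lighter law has the smaller exact deficit on every datum) and
  **`datumDeficit_anti_shell`**-type pooling via part 3f; **`datumDeficit_eq_zero_iff`** (`u_w > 0`: `DD(datum) = 0 ⟺` every place saturates);
  **`datumDeficit_le_datumOff`**: with `q_w = m_w·u_w`, `DD(datum) ≤ T(datum)` (part 3f `den·DD_w ≤ m_w·T_w`), i.e. **`K_L1 ≥ K_L0` at every datum, every law**.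
* §2 THE CELL OF RECORD over part 2's `reqThreshold μ₀ M K = (μ₀M − K)⁺` with `K = K_L1 = M − D`: `reqThreshold_sub_eq_zero_iff` — **`reqThreshold μ₀ M (M − D) = 0
  ⟺ D ≤ (1 − μ₀)·M`** (`ρ ≥ 1` iff the exact deficit mass is at most the slack `(1 − μ₀)M` the target leaves); `reqThreshold_L1_le_L0` (`K_L1 ≥ K_L0` ⟹ the tier-L1
  threshold is below the strict twin's: MEETS at tier L0 implies MEETS at tier L1, REQB (P2) `ρ ≥ ρ⁰`); so for EVERY law the row's deciding inequality per datum
  reads `datumDeficit ≤ (1 − μ₀)·reqMass` — the shape the per-pair kernel faces (rh-typ-1…12) instantiate with the engines' integers.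
* §3 WORKED PLACE FREY `p = 7`, `l = 107` read as a one-place datum (print: `MM = 210·50986 = 10707060`, `DD = 2471121`, part 3f): `μ_ex = K_L1/M = 8235939/10707060`
  (`= 0.76921`, referee WP-GRID); the words by integer comparison `DD ≤ (1 − μ₀)·MM`: `μ₀ = 27/64`: `64·2471121 ≤ 37·10707060` ✓ · `1/2`: `2·2471121 ≤ 10707060` ✓ ·
  `3/4`: `4·2471121 = 9884484 ≤ 10707060` ✓ · `1`: `2471121 > 0` ✗ — i.e. `ρ_L1 = 0.7692/μ₀ ≥ 1` iff `μ₀ ≤ 0.769` (grid: `Lambda_tgt = 1: rho_L1 0.7692`).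
HONEST FRAMING: real/integer bookkeeping about OUR typed functional with a free pilot law (a PARAMETER — REQB-SPEC FRAMING; CONSISTENCY = abc-iut-reqb-rf-1's
column); no netting tier and no cone price typed here; the bed's MEETS counts are the engines' (A ≡ B) and the per-pair faces'; nothing here asserts that abc is
proved or refuted, or that [IUTchIII] Cor. 3.12 / [IUTchIV] Thm. 1.10 holds or fails at any datum, or takes a side on any author; typed ≠ proved; computed ≠
proved. [claim: Mochizuki2012, status: disputed] for every IUT locution. [cite: Mochizuki2012, IUTchIII Cor. 3.12 p. 173–174; IUTchIV Prop. 1.4 p. 13, Thm. 1.10 Step (v) p. 27–29]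
-/

noncomputable section

open Finset

namespace Summit.ABC.IUTFork.Repair.RH.ReqsideWeightLaws

/-! ## §1. The exact deficit of a datum; `K_L1 ≥ K_L0` -/

/-- **DATUM-LEVEL EXACT DEFICIT** `Σ_{w ∈ s} DD_w·u_w` (nats; `u_w = ln p_w/(e_w·l⋆) ≥ 0` the place weight WITHOUT the depth `m_q`, which `DD_w` already carries).
So `K_L1(datum) = M(datum) − datumDeficit`. [claim: Mochizuki2012, status: disputed] -/
@[claim "Mochizuki2012" "disputed"]
def datumDeficit {ι : Type*} (f : ℕ → ℤ) (den : ℤ) (s : Finset ι) (e m δ rin rout : ι → ℤ) (u : ι → ℝ) (L : ℕ) : ℝ :=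
  ∑ w ∈ s, ((exactDeficit f den (e w) (m w) (δ w) (rin w) (rout w) L : ℤ) : ℝ) * u w

section Datum

variable {ι : Type*} {s : Finset ι} {e m δ rin rout : ι → ℤ} {u : ι → ℝ}

/-- `DD(datum) ≥ 0` (weights `≥ 0`). [folklore] -/
theorem datumDeficit_nonneg (f : ℕ → ℤ) (den : ℤ) (hu : ∀ w ∈ s, 0 ≤ u w) (L : ℕ) : 0 ≤ datumDeficit f den s e m δ rin rout u L := by
  unfold datumDeficit
  exact Finset.sum_nonneg fun w hw => mul_nonneg (by exact_mod_cast exactDeficit_nonneg f den _ _ _ _ _ L) (hu w hw)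

/-- **`DD(datum)` IS MONOTONE IN THE PILOT LAW** (cross-denominator `f/den ≤ g/den′` on labels `≥ 1`; every place `e_w > 0`, `m_w ≥ 0`, `u_w ≥ 0`).
[folklore] -/
theorem datumDeficit_mono_law {f g : ℕ → ℤ} {den den' : ℤ} (hden : 0 < den) (hden' : 0 < den') (he : ∀ w ∈ s, 0 < e w)
    (hm : ∀ w ∈ s, 0 ≤ m w) (hu : ∀ w ∈ s, 0 ≤ u w) (hfg : ∀ j, 1 ≤ j → f j * den' ≤ g j * den) (L : ℕ) :
    datumDeficit f den s e m δ rin rout u L ≤ datumDeficit g den' s e m δ rin rout u L := by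
  unfold datumDeficit
  refine Finset.sum_le_sum fun w hw => mul_le_mul_of_nonneg_right ?_ (hu w hw)
  exact_mod_cast exactDeficit_mono_law hden hden' (he w hw) (hm w hw) hfg L

/-- **`DD(datum)` IS ANTITONE IN THE ALLOWANCE** place by place (`δ_w ≤ δ′_w`, `r_in,w ≤ r_in′,w`, `r_out′,w ≤ r_out,w`; `den > 0`, `e_w > 0`, `u_w ≥ 0`).
[folklore] -/
theorem datumDeficit_anti_shell {f : ℕ → ℤ} {den : ℤ} {δ' rin' rout' : ι → ℤ} (hden : 0 < den) (he : ∀ w ∈ s, 0 < e w) (hu : ∀ w ∈ s, 0 ≤ u w)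
    (hδ : ∀ w ∈ s, δ w ≤ δ' w) (hi : ∀ w ∈ s, rin w ≤ rin' w) (ho : ∀ w ∈ s, rout' w ≤ rout w) (L : ℕ) :
    datumDeficit f den s e m δ' rin' rout' u L ≤ datumDeficit f den s e m δ rin rout u L := by
  unfold datumDeficit
  refine Finset.sum_le_sum fun w hw => mul_le_mul_of_nonneg_right ?_ (hu w hw)
  exact_mod_cast exactDeficit_anti_shell hden (he w hw) (hδ w hw) (hi w hw) (ho w hw) L

/-- **`DD(datum) = 0 ⟺ EVERY PLACE SATURATES`** (weights `u_w > 0`). [folklore] -/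
theorem datumDeficit_eq_zero_iff (f : ℕ → ℤ) (den : ℤ) (hu : ∀ w ∈ s, 0 < u w) (L : ℕ) :
    datumDeficit f den s e m δ rin rout u L = 0 ↔
      ∀ w ∈ s, ∀ j, 1 ≤ j → j ≤ L → Cell f den (e w) (m w) (δ w) (rin w) (rout w) j := by
  unfold datumDeficit
  rw [Finset.sum_eq_zero_iff_of_nonneg (fun w hw => mul_nonneg (by exact_mod_cast exactDeficit_nonneg f den _ _ _ _ _ L) (hu w hw).le)]
  refine ⟨fun h w hw => ?_, fun h w hw => ?_⟩
  · have h1 := h w hw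
    rcases mul_eq_zero.mp h1 with h2 | h2
    · exact (exactDeficit_eq_zero_iff f den _ _ _ _ _ L).1 (by exact_mod_cast h2)
    · exact absurd h2 (hu w hw).ne'
  · rw [(exactDeficit_eq_zero_iff f den _ _ _ _ _ L).2 (h w hw)]
    simp

/-- **`K_L1 ≥ K_L0` AT EVERY DATUM, EVERY LAW**: with the mass weights `q_w = m_w·u_w` of parts 3b–3e, `DD(datum) ≤ T(datum)` (part 3f `den·DD_w ≤ m_w·T_w`;
`den > 0`, `e_w > 0`, `m_w ≥ 0`, `δ_w ≥ 0`, `r_out,w ≤ r_in,w`, `u_w ≥ 0`, demands `≥ 0`). [folklore] -/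
theorem datumDeficit_le_datumOff {f : ℕ → ℤ} {den : ℤ} (hden : 0 < den) (he : ∀ w ∈ s, 0 < e w) (hm : ∀ w ∈ s, 0 ≤ m w)
    (hδ : ∀ w ∈ s, 0 ≤ δ w) (hG : ∀ w ∈ s, rout w ≤ rin w) (hu : ∀ w ∈ s, 0 ≤ u w) (hf : ∀ j, 1 ≤ j → den ≤ f j) (L : ℕ) :
    datumDeficit f den s e m δ rin rout u L ≤ datumOff f den s e m δ rin rout (fun w => (m w : ℝ) * u w) L := by
  unfold datumDeficit datumOff
  refine Finset.sum_le_sum fun w hw => ?_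
  have hd : (0 : ℝ) < (den : ℝ) := by exact_mod_cast hden
  have h := den_mul_exactDeficit_le hden (he w hw) (hm w hw) (hδ w hw) (hG w hw) hf L
    (e := e w) (m := m w) (δ := δ w) (rin := rin w) (rout := rout w)
  have h' : (den : ℝ) * (exactDeficit f den (e w) (m w) (δ w) (rin w) (rout w) L : ℝ) ≤
      (m w : ℝ) * (offDemand f den (e w) (m w) (δ w) (rin w) (rout w) L : ℝ) := by exact_mod_cast h
  rw [div_mul_eq_mul_div, le_div_iff₀ hd]
  nlinarith [hu w hw]

end Datum

/-! ## §2. The MEETS cell of record in typed form -/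

/-- **THE CELL OF RECORD**: with kept mass `K = K_L1 = M − D` (`D` = the exact-deficit mass), `reqThreshold μ₀ M (M − D) = 0 ⟺ D ≤ (1 − μ₀)·M` — `ρ = K_L1/(μ₀M) ≥ 1`
iff the exact deficit fits in the slack the target leaves (part 2 `reqThreshold_eq_zero_iff`). [folklore] -/
theorem reqThreshold_sub_eq_zero_iff (μ₀ M D : ℝ) : reqThreshold μ₀ M (M - D) = 0 ↔ D ≤ (1 - μ₀) * M := by
  rw [reqThreshold_eq_zero_iff]
  constructor <;> intro h <;> linarith

/-- **MEETS AT TIER L0 ⟹ MEETS AT TIER L1** (`K_L1 ≥ K_L0`: the threshold is antitone in the kept mass, part 3b `reqThreshold_anti_K`): for every law and datum,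
`reqThreshold μ₀ M K_L1 ≤ reqThreshold μ₀ M K_L0`; in particular `ρ⁰ ≥ 1 ⟹ ρ ≥ 1` (REQB (P2)). [folklore] -/
theorem reqThreshold_L1_le_L0 {μ₀ M KL0 KL1 : ℝ} (h : KL0 ≤ KL1) : reqThreshold μ₀ M KL1 ≤ reqThreshold μ₀ M KL0 :=
  reqThreshold_anti_K h μ₀ M

section Datum

variable {ι : Type*} {s : Finset ι} {e m δ rin rout : ι → ℤ} {u : ι → ℝ}

/-- **THE ROW'S DECIDING INEQUALITY PER DATUM, TYPED**: `T_{L1}(μ₀) := reqThreshold μ₀ M (M − DD(datum))` vanishes iff `datumDeficit ≤ (1 − μ₀)·M` with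
`M = reqMass f den L (Σ_w m_w u_w)` (part 2) — the shape every per-pair kernel face instantiates with the engines' integers. [folklore] -/
theorem datum_meets_iff (f : ℕ → ℤ) (den : ℤ) (μ₀ : ℝ) (L : ℕ) :
    reqThreshold μ₀ (reqMass f den L (∑ w ∈ s, (m w : ℝ) * u w))
        (reqMass f den L (∑ w ∈ s, (m w : ℝ) * u w) - datumDeficit f den s e m δ rin rout u L) = 0 ↔
      datumDeficit f den s e m δ rin rout u L ≤ (1 - μ₀) * reqMass f den L (∑ w ∈ s, (m w : ℝ) * u w) :=
  reqThreshold_sub_eq_zero_iff _ _ _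

/-- … and the tier-L1 threshold is below the tier-L0 one at every datum (`0 ≤ μ₀`; hypotheses of `datumDeficit_le_datumOff`), BY NAME over parts 2/3b:
`M − DD(datum) ≥ M − T(datum) = K_L0(datum)` (part 3b `datumKept_add_datumOff`). [folklore] -/
theorem datum_reqThreshold_L1_le_L0 {f : ℕ → ℤ} {den : ℤ} (hden : 0 < den) (he : ∀ w ∈ s, 0 < e w) (hm : ∀ w ∈ s, 0 ≤ m w)
    (hδ : ∀ w ∈ s, 0 ≤ δ w) (hG : ∀ w ∈ s, rout w ≤ rin w) (hu : ∀ w ∈ s, 0 ≤ u w) (hf : ∀ j, 1 ≤ j → den ≤ f j) (μ₀ : ℝ) (L : ℕ) :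
    reqThreshold μ₀ (reqMass f den L (∑ w ∈ s, (m w : ℝ) * u w))
        (reqMass f den L (∑ w ∈ s, (m w : ℝ) * u w) - datumDeficit f den s e m δ rin rout u L) ≤
      reqThreshold μ₀ (reqMass f den L (∑ w ∈ s, (m w : ℝ) * u w)) (datumKept f den s e m δ rin rout (fun w => (m w : ℝ) * u w) L) := by
  refine reqThreshold_L1_le_L0 ?_
  have h1 := datumDeficit_le_datumOff hden he hm hδ hG hu hf L (s := s) (δ := δ) (rin := rin) (rout := rout)
  have h2 := datumKept_add_datumOff (s := s) (e := e) (m := m) (δ := δ) (rin := rin) (rout := rout) (q := fun w => (m w : ℝ) * u w) f den L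
  linarith

end Datum

/-! ## §3. The worked place as a one-place datum -/

/-- WORKED PLACE FREY `p = 7`, `l = 107` (print; `MM = 210·50986 = 10707060`, `DD = 2471121`, parts 3b/3f): the tier-L1 words by integer comparison
`DD ≤ (1 − μ₀)·MM` — `μ₀ = 27/64` ✓ (`64·DD ≤ 37·MM`), `1/2` ✓, `3/4` ✓ (`4·2471121 = 9884484 ≤ 10707060`), `1` ✗ (`DD > 0`): `ρ_L1 = (8235939/10707060)/μ₀ ≥ 1`
iff `μ₀ ≤ 0.76921` (referee WP-GRID `mu_ex 0.76921`, `rho_L1 0.7692` at `Λ_tgt = 1`). [folklore] -/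
theorem worked_tierL1_words :
    exactDeficit (fun j => (j : ℤ) ^ 2) 1 1605 210 1604 268 (-4472) 53 = 2471121 ∧
      210 * demandSum (fun j => (j : ℤ) ^ 2) 1 53 = 10707060 ∧
        64 * (2471121 : ℤ) ≤ 37 * 10707060 ∧ 2 * (2471121 : ℤ) ≤ 10707060 ∧ 4 * (2471121 : ℤ) ≤ 10707060 ∧ ¬ ((2471121 : ℤ) ≤ 0) := by
  refine ⟨worked_exactDeficit.1, ?_, by norm_num, by norm_num, by norm_num, by norm_num⟩
  have h := six_mul_demandSum_sq 53
  push_cast at h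
  linarith

end Summit.ABC.IUTFork.Repair.RH.ReqsideWeightLaws

end
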